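import Literature.Topology.FourManifolds.HomotopySpheresGroupDischarge
import Literature.Topology.FourManifolds.HCobordismThreeLeaves
import Literature.Topology.FourManifolds.SPC4Wave0Proofs
import Literature.Topology.FourManifolds.HCobordismIntersectionNumberSlabProofs
import HarnessLib

/-!
# The group of homotopy spheres (Kervaire–Milnor 1963, Thm. 1.1): the residue, by name

Sibling proof file of `Literature.Topology.FourManifolds.HomotopySpheres` for the named fact
`Literature.Topology.FourManifolds.exists_commGroup_homotopySphereClass` (for `n ≠ 0, 4`,
`Θₙ = HomotopySphereClass n` — oriented homotopy `n`-spheres modulo orientation-preserving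
diffeomorphism — is a commutative group under connected sum, unit `[𝕊ⁿ]`, inverse `[-Σ]`) and
its source-faithful variant
`Literature.Topology.FourManifolds.exists_commGroup_homotopySphereClass_of_ne_three`
(`n ≠ 0, 3, 4`; `HomotopySpheresGroupLeaves.lean`).  No definition, no statement and no named
fact is introduced or changed; nothing is restated (net debt `0`).

`HomotopySpheresGroupDischarge.lean` proves both facts from Smale's h-cobordism theorem in the
form of Milnor 1965, Thm. 9.2 (`nonempty_diffeomorph_of_isHCobordant_of_five_le`, a named fact),
the tree's fact needing in addition the Poincaré conjecture
(`nonempty_diffeomorph_sphere_three`, a named fact) for its instance `n = 3`.  Since then the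
tree has reduced Thm. 9.2 to the three leaves of Milnor's proof DAG that are still named facts
(`nonempty_diffeomorph_of_isHCobordant_of_five_le_of_three_leaves`, `HCobordismThreeLeaves.lean`)
and the smooth Poincaré conjecture to its topological form plus the uniqueness of smooth
structures in dimension `≤ 3` (`nonempty_diffeomorph_sphere_three_of_homeomorph`,
`SPC4Wave0Proofs.lean`).  This file composes, so that each fact is ONE term in the `…_holds`
of exactly the named facts it still rests on:

* `exists_commGroup_homotopySphereClass_of_ne_three_of_three_leaves` — Kervaire–Milnor's
  Thm. 1.1 for diffeomorphism classes in the printed range `n ≠ 0, 3, 4` GIVEN only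
  B = `Cobordism.Milnor1965_basisTheorem_slab` (Milnor 1965, Thm. 7.6 on a slab),
  I = `Cobordism.Milnor1965_intersectionNumber_slab` (Cor. 7.3 on a slab),
  W = `Milnor1965_whitney_isotopy` (Thm. 6.6 with its Remark);
* `exists_commGroup_homotopySphereClass_of_three_leaves_of_poincare` — the tree's fact
  (`n ≠ 0, 4`) GIVEN B, I, W and P = `nonempty_diffeomorph_sphere_three` (Perelman);
* `exists_commGroup_homotopySphereClass_of_three_leaves_of_homeomorph` — the same with P
  replaced by its two tree leaves, the topological Poincaré conjecture
  `nonempty_homeomorph_sphere_three` (Perelman 2002–03; Morgan–Tian 2007, Cor. 0.2 (a)) and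
  `nonempty_diffeomorph_of_homeomorph_of_le_three` (Munkres 1960 / Whitehead 1961: homeomorphic
  smooth manifolds of dimension `≤ 3` are diffeomorphic).

Second instalment (the residue after Cor. 7.3 on a slab landed): I is now a THEOREM of the tree
(`Cobordism.Milnor1965_intersectionNumber_slab_holds`, `HCobordismIntersectionNumberSlabProofs.lean`,
from Milnor's Lemma 7.2 on the slab), so each of the three theorems above loses the hypothesis
`hI`:

* `exists_commGroup_homotopySphereClass_of_ne_three_of_two_leaves` — Thm. 1.1 for
  diffeomorphism classes, `n ≠ 0, 3, 4`, GIVEN only B and W;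
* `exists_commGroup_homotopySphereClass_of_two_leaves_of_poincare` — the tree's fact GIVEN B, W, P;
* `exists_commGroup_homotopySphereClass_of_two_leaves_of_homeomorph` — the tree's fact GIVEN B, W,
  the topological Poincaré conjecture and smoothing uniqueness in dimension `≤ 3`.

Why P cannot be avoided for the tree's fact: its instance `n = 3` makes every class of
`Θ₃` invertible with inverse `[-Σ]`, i.e. `Σ # (-Σ) ≅ S³` for every homotopy `3`-sphere `Σ`,
whereas the cited source stops short of `n = 3` — Kervaire–Milnor, p. 505: *"Smale has proved
[26] that two homotopy n-spheres, n ≠ 3, 4, are h-cobordant if and only if they are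
diffeomorphic"*, and p. 507: *"If the Poincaré hypothesis were proved, it would follow that Θ₃
is zero; but at present the structure of Θ₃ remains unknown."*

## References

* M. Kervaire, J. Milnor, *Groups of homotopy spheres I*, Ann. of Math. 77 (1963), 504–537:
  Thm. 1.1 (p. 504), Remark p. 505, §2 Lemmas 2.1–2.4 (pp. 505–507), p. 507.  Held:
  `lit read paper:doi-10-2307-1970128` (PDF pp. 2–5). [KervaireMilnorAnnals1963]
* J. Milnor, *Lectures on the h-cobordism theorem* (1965): Thm. 9.1, 9.2 (PDF p. 57), Thm. 7.6
  (PDF pp. 49–50), Cor. 7.3 (PDF p. 47), Thm. 6.6 and Remark (PDF pp. 38–39). [MilnorHCobordism1965]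
* J. Morgan, G. Tian, *Ricci flow and the Poincaré conjecture* (2007), Cor. 0.2 (a) and p. ix
  fn. 1. [MorganTian2007]
-/

noncomputable section

namespace Literature.Topology.FourManifolds

/-- **Kervaire–Milnor 1963, Thm. 1.1 for diffeomorphism classes, `n ≠ 0, 3, 4`, from the three
leaves B, I, W of Milnor's proof of the h-cobordism theorem.**  The named fact
`Literature.Topology.FourManifolds.exists_commGroup_homotopySphereClass_of_ne_three` GIVEN the
Basis Theorem 7.6 on a slab (`Cobordism.Milnor1965_basisTheorem_slab`), Cor. 7.3 on a slab
(`Cobordism.Milnor1965_intersectionNumber_slab`) and the Whitney procedure Thm. 6.6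
(`Milnor1965_whitney_isotopy`): these give Milnor's Thm. 9.2
(`nonempty_diffeomorph_of_isHCobordant_of_five_le_of_three_leaves`), whence the claim by
`exists_commGroup_homotopySphereClass_of_ne_three_of_hCobordism` (all of Kervaire–Milnor §2 and
`Θ₁ = Θ₂ = 0` being theorems of the tree).  The discharge
`exists_commGroup_homotopySphereClass_of_ne_three_holds` is this theorem applied to the three
`_holds`, once they land.
[cite: KervaireMilnorAnnals1963, Thm. 1.1 (p. 504), Remark p. 505, §2 pp. 505–507] [cite: MilnorHCobordism1965, Thm. 9.2 (PDF p. 57), Thm. 7.6, Cor. 7.3, Thm. 6.6] -/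
theorem exists_commGroup_homotopySphereClass_of_ne_three_of_three_leaves
    (hB : Cobordism.Milnor1965_basisTheorem_slab.{0})
    (hI : Cobordism.Milnor1965_intersectionNumber_slab.{0})
    (hW : Milnor1965_whitney_isotopy.{0, 0, 0}) :
    exists_commGroup_homotopySphereClass_of_ne_three :=
  exists_commGroup_homotopySphereClass_of_ne_three_of_hCobordism
    (nonempty_diffeomorph_of_isHCobordant_of_five_le_of_three_leaves hB hI hW)

/-- **The tree's fact `exists_commGroup_homotopySphereClass` (`n ≠ 0, 4`) from the four named
facts it still rests on**: the leaves B, I, W of the h-cobordism theorem (as in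
`exists_commGroup_homotopySphereClass_of_ne_three_of_three_leaves`) and, for the instance `n = 3`
only, the Poincaré conjecture P (`nonempty_diffeomorph_sphere_three`: a closed simply connected
smooth `3`-manifold is diffeomorphic to `S³`); by
`exists_commGroup_homotopySphereClass_of_hCobordism_of_poincare`.  Kervaire–Milnor do not claim the
instance `n = 3` for diffeomorphism classes (p. 505: Smale's theorem for `n ≠ 3, 4`; p. 507: "at
present the structure of `Θ₃` remains unknown").
[cite: KervaireMilnorAnnals1963, Thm. 1.1 (p. 504), Remark p. 505, p. 507] [cite: MilnorHCobordism1965, Thm. 9.2 (PDF p. 57)] [cite: MorganTian2007, Cor. 0.2 (a)] -/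
theorem exists_commGroup_homotopySphereClass_of_three_leaves_of_poincare
    (hB : Cobordism.Milnor1965_basisTheorem_slab.{0})
    (hI : Cobordism.Milnor1965_intersectionNumber_slab.{0})
    (hW : Milnor1965_whitney_isotopy.{0, 0, 0})
    (hP : FourManifolds.nonempty_diffeomorph_sphere_three.{0}) :
    exists_commGroup_homotopySphereClass :=
  exists_commGroup_homotopySphereClass_of_hCobordism_of_poincare
    (nonempty_diffeomorph_of_isHCobordant_of_five_le_of_three_leaves hB hI hW) hP

/-- **The tree's fact `exists_commGroup_homotopySphereClass` (`n ≠ 0, 4`) with the Poincaré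
conjecture split into its two tree leaves**: the topological Poincaré conjecture
(`nonempty_homeomorph_sphere_three`; Perelman 2002–03, Morgan–Tian 2007, Cor. 0.2 (a)) and the
uniqueness of smooth structures in dimension `≤ 3`
(`nonempty_diffeomorph_of_homeomorph_of_le_three`; Munkres 1960, Whitehead 1961), which give P by
`nonempty_diffeomorph_sphere_three_of_homeomorph` (`SPC4Wave0Proofs.lean`); then
`exists_commGroup_homotopySphereClass_of_three_leaves_of_poincare`.
[cite: KervaireMilnorAnnals1963, Thm. 1.1 (p. 504), p. 507] [cite: MilnorHCobordism1965, Thm. 9.2 (PDF p. 57)] [cite: MorganTian2007, Cor. 0.2 (a) and p. ix fn. 1] -/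
theorem exists_commGroup_homotopySphereClass_of_three_leaves_of_homeomorph
    (hB : Cobordism.Milnor1965_basisTheorem_slab.{0})
    (hI : Cobordism.Milnor1965_intersectionNumber_slab.{0})
    (hW : Milnor1965_whitney_isotopy.{0, 0, 0})
    (hTop : FourManifolds.nonempty_homeomorph_sphere_three.{0})
    (hUnique : FourManifolds.nonempty_diffeomorph_of_homeomorph_of_le_three.{0, 0}) :
    exists_commGroup_homotopySphereClass :=
  exists_commGroup_homotopySphereClass_of_three_leaves_of_poincare hB hI hW
    (nonempty_diffeomorph_sphere_three_of_homeomorph hTop hUnique)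

/-! ### The residue after Cor. 7.3 on a slab landed: two leaves (B, W) -/

/-- **Kervaire–Milnor 1963, Thm. 1.1 for diffeomorphism classes, `n ≠ 0, 3, 4`, from the two
leaves B, W of Milnor's proof of the h-cobordism theorem that are still named facts.**  The named
fact `Literature.Topology.FourManifolds.exists_commGroup_homotopySphereClass_of_ne_three` GIVEN
the Basis Theorem 7.6 on a slab (`Cobordism.Milnor1965_basisTheorem_slab`) and the Whitney
procedure Thm. 6.6 (`Milnor1965_whitney_isotopy`) only: Cor. 7.3 on a slab is now the tree
theorem `Cobordism.Milnor1965_intersectionNumber_slab_holds` (from Lemma 7.2 on the slab), fed to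
`exists_commGroup_homotopySphereClass_of_ne_three_of_three_leaves`.  The discharge
`exists_commGroup_homotopySphereClass_of_ne_three_holds` is this theorem applied to the two
remaining `_holds`, once they land; nothing of B, W is restated here.
[cite: KervaireMilnorAnnals1963, Thm. 1.1 (p. 504), Remark p. 505, §2 pp. 505–507] [cite: MilnorHCobordism1965, Thm. 9.2 (PDF p. 57), Thm. 7.6 (PDF p. 50), Cor. 7.3 (PDF p. 47), Thm. 6.6 and Remark (PDF pp. 38–39)] -/
theorem exists_commGroup_homotopySphereClass_of_ne_three_of_two_leaves
    (hB : Cobordism.Milnor1965_basisTheorem_slab.{0})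
    (hW : Milnor1965_whitney_isotopy.{0, 0, 0}) :
    exists_commGroup_homotopySphereClass_of_ne_three :=
  exists_commGroup_homotopySphereClass_of_ne_three_of_three_leaves hB
    Cobordism.Milnor1965_intersectionNumber_slab_holds hW

/-- **The tree's fact `exists_commGroup_homotopySphereClass` (`n ≠ 0, 4`) from the three named
facts it still rests on**: B, W (as in
`exists_commGroup_homotopySphereClass_of_ne_three_of_two_leaves`) and, for the instance `n = 3`
only, the Poincaré conjecture P (`nonempty_diffeomorph_sphere_three`); by
`exists_commGroup_homotopySphereClass_of_three_leaves_of_poincare` with I discharged by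
`Cobordism.Milnor1965_intersectionNumber_slab_holds`.
[cite: KervaireMilnorAnnals1963, Thm. 1.1 (p. 504), Remark p. 505, p. 507] [cite: MilnorHCobordism1965, Thm. 9.2 (PDF p. 57), Cor. 7.3 (PDF p. 47)] [cite: MorganTian2007, Cor. 0.2 (a)] -/
theorem exists_commGroup_homotopySphereClass_of_two_leaves_of_poincare
    (hB : Cobordism.Milnor1965_basisTheorem_slab.{0})
    (hW : Milnor1965_whitney_isotopy.{0, 0, 0})
    (hP : FourManifolds.nonempty_diffeomorph_sphere_three.{0}) :
    exists_commGroup_homotopySphereClass :=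
  exists_commGroup_homotopySphereClass_of_three_leaves_of_poincare hB
    Cobordism.Milnor1965_intersectionNumber_slab_holds hW hP

/-- **The tree's fact `exists_commGroup_homotopySphereClass` (`n ≠ 0, 4`) from B, W and the two
tree leaves of the Poincaré conjecture** — the topological Poincaré conjecture
(`nonempty_homeomorph_sphere_three`; Perelman 2002–03, Morgan–Tian 2007, Cor. 0.2 (a)) and the
uniqueness of smooth structures in dimension `≤ 3`
(`nonempty_diffeomorph_of_homeomorph_of_le_three`; Munkres 1960, Whitehead 1961) —; by
`exists_commGroup_homotopySphereClass_of_three_leaves_of_homeomorph` with I discharged by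
`Cobordism.Milnor1965_intersectionNumber_slab_holds`.
[cite: KervaireMilnorAnnals1963, Thm. 1.1 (p. 504), p. 507] [cite: MilnorHCobordism1965, Thm. 9.2 (PDF p. 57), Cor. 7.3 (PDF p. 47)] [cite: MorganTian2007, Cor. 0.2 (a) and p. ix fn. 1] -/
theorem exists_commGroup_homotopySphereClass_of_two_leaves_of_homeomorph
    (hB : Cobordism.Milnor1965_basisTheorem_slab.{0})
    (hW : Milnor1965_whitney_isotopy.{0, 0, 0})
    (hTop : FourManifolds.nonempty_homeomorph_sphere_three.{0})
    (hUnique : FourManifolds.nonempty_diffeomorph_of_homeomorph_of_le_three.{0, 0}) :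
    exists_commGroup_homotopySphereClass :=
  exists_commGroup_homotopySphereClass_of_three_leaves_of_homeomorph hB
    Cobordism.Milnor1965_intersectionNumber_slab_holds hW hTop hUnique

end Literature.Topology.FourManifolds

end
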